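import Literature.Probability.RandomPlanarGeometry.SAWTriangularLoopSurgery
import Literature.Probability.RandomPlanarGeometry.SAWTriangularEndpointMonotone
import HarnessLib

/-!
# Splicing a block into a self-avoiding walk of `𝕋`; the polygon read as a path («TRI-SAP-RATIO-RATE», G2ʷ — part 1 of 4)

Topic `Literature/Probability/RandomPlanarGeometry` (lane «pcv-sawmu», routes R82 «TRI-SAP-RATIO(-RATE)» and R83
«TRI-ENDPOINT-RATIO-RATE»: the one-step ratio theorems with Kesten's rate for self-avoiding polygons / fixed-endpoint
walks on the triangular lattice `𝕋`). Source: N. Madras, G. Slade, *The Self-Avoiding Walk* (1993), §3.2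
(concatenation of self-avoiding polygons, proof of Theorem 3.2.3: a polygon is translated next to an extremal vertex of
another one and the two are joined by exchanging two parallel edges for two connecting edges), used as the insertion
input of Theorem 7.4.5 (c) p. 254. The book works on `ℤ^d`; on `𝕋` the join is done by the explicit gadgets of part 3
(`SAWTriangularPolygonInsertionStep.lean`); this part is the lattice-independent list bookkeeping.

## Contents (namespace `Literature.Probability.RandomPlanarGeometry.SAW.PolygonInsertion`; all PROVED, axioms standard)

* `splice s Λ ω = ω.take (s+1) ++ Λ ++ ω.drop (s+1)`; access lemmas `getD_splice_of_le / _block / _of_ge`, inverses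
  `take_append_drop_splice` (the walk back) and `take_drop_splice` (the block back);
  **`splice_mem_triSL`**: a self-avoiding chain `Λ`, disjoint from `ω ∈ S_N(𝕋)`, glued by two edges after `ω_s`,
  gives a walk of `S_{N+|Λ|}(𝕋)` (same origin; `getD_splice_last`: same endpoint);
* `rot`, `rotInv` (rotation / reversed rotation of `ℤ/m` without `%`), **`polyPath lam τ r d`** (the polygon `lam`,
  a vertex list of `loopSL`, read from index `r` in direction `d`, translated by `τ`), `polyDecode` and
  **`polyDecode_polyPath`** (the rooted polygon is recovered from its path given `r`, `d`), `mem_polyPath_iff`,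
  `head?_polyPath`, `getLast?_polyPath`, **`polyPath_isChain`**, **`polyPath_nodup`**.
-/

noncomputable section

open Finset Literature.Probability.LatticeModels Literature.Probability.Percolation SimpleGraph
open scoped BigOperators

namespace Literature.Probability.RandomPlanarGeometry.SAW

namespace PolygonInsertion

/-! ### Splicing a block after position `s` -/

/-- Insert the block `Λ` between `ω_s` and `ω_{s+1}`. [cite: MadrasSlade1993, §3.2 (concatenation of polygons)] -/
def splice (s : ℕ) (Λ ω : List (Site 2)) : List (Site 2) := ω.take (s + 1) ++ Λ ++ ω.drop (s + 1)

variable {N s : ℕ} {ω Λ : List (Site 2)}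

/-- Length of the splice. [cite: MadrasSlade1993, §3.2 (concatenation of polygons; bookkeeping)] -/
theorem length_splice (hs : s + 1 ≤ ω.length) : (splice s Λ ω).length = ω.length + Λ.length := by
  simp only [splice, List.length_append, List.length_take, List.length_drop]
  omega

/-- Entries of the splice before the block. [cite: MadrasSlade1993, §3.2 (concatenation of polygons; bookkeeping)] -/
theorem getD_splice_of_le (hs : s + 1 ≤ ω.length) {i : ℕ} (hi : i ≤ s) :
    (splice s Λ ω).getD i 0 = ω.getD i 0 := by
  simp only [splice, List.append_assoc]
  rw [List.getD_append _ _ _ _ (by rw [List.length_take]; omega), List.getD_eq_getElem?_getD,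
    List.getElem?_take_of_lt (by omega), ← List.getD_eq_getElem?_getD]

/-- Entries of the splice inside the block. [cite: MadrasSlade1993, §3.2 (concatenation of polygons; bookkeeping)] -/
theorem getD_splice_block (hs : s + 1 ≤ ω.length) {k : ℕ} (hk : k < Λ.length) :
    (splice s Λ ω).getD (s + 1 + k) 0 = Λ.getD k 0 := by
  simp only [splice, List.append_assoc]
  rw [List.getD_append_right _ _ _ _ (by rw [List.length_take]; omega), List.length_take,
    show s + 1 + k - min (s + 1) ω.length = k by rw [min_eq_left hs]; omega,
    List.getD_append _ _ _ _ hk]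

/-- Entries of the splice after the block. [cite: MadrasSlade1993, §3.2 (concatenation of polygons; bookkeeping)] -/
theorem getD_splice_of_ge (hs : s + 1 ≤ ω.length) {i : ℕ} (hi : s + 1 + Λ.length ≤ i) :
    (splice s Λ ω).getD i 0 = ω.getD (i - Λ.length) 0 := by
  simp only [splice, List.append_assoc]
  rw [List.getD_append_right _ _ _ _ (by rw [List.length_take]; omega), List.length_take,
    min_eq_left hs, List.getD_append_right _ _ _ _ (by omega), List.getD_eq_getElem?_getD,
    List.getElem?_drop, ← List.getD_eq_getElem?_getD]
  congr 1
  omega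

/-- The walk is recovered from the splice: prefix. [cite: MadrasSlade1993, §3.2 (concatenation of polygons; bookkeeping)] -/
theorem take_splice (hs : s + 1 ≤ ω.length) : (splice s Λ ω).take (s + 1) = ω.take (s + 1) := by
  simp only [splice, List.append_assoc]
  rw [List.take_append_of_le_length (by rw [List.length_take]; omega), List.take_take, min_self]

/-- The walk is recovered from the splice: suffix. [cite: MadrasSlade1993, §3.2 (concatenation of polygons; bookkeeping)] -/
theorem drop_splice (hs : s + 1 ≤ ω.length) : (splice s Λ ω).drop (s + 1 + Λ.length) = ω.drop (s + 1) := by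
  have h1 : (ω.take (s + 1)).length = s + 1 := by rw [List.length_take]; omega
  simp only [splice, List.append_assoc]
  rw [List.drop_append, List.drop_eq_nil_of_le (by omega), List.nil_append, h1,
    show s + 1 + Λ.length - (s + 1) = Λ.length by omega, List.drop_append, List.drop_eq_nil_of_le le_rfl,
    List.nil_append, Nat.sub_self, List.drop_zero]

/-- The walk is recovered from the splice. [cite: MadrasSlade1993, §3.2 (concatenation of polygons; bookkeeping)] -/
theorem take_append_drop_splice (hs : s + 1 ≤ ω.length) :
    (splice s Λ ω).take (s + 1) ++ (splice s Λ ω).drop (s + 1 + Λ.length) = ω := by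
  rw [take_splice hs, drop_splice hs, List.take_append_drop]

/-- The block is recovered from the splice. [cite: MadrasSlade1993, §3.2 (concatenation of polygons; bookkeeping)] -/
theorem take_drop_splice (hs : s + 1 ≤ ω.length) : ((splice s Λ ω).drop (s + 1)).take Λ.length = Λ := by
  simp only [splice, List.append_assoc]
  rw [List.drop_append_of_le_length (by rw [List.length_take]; omega),
    List.drop_eq_nil_of_le (by rw [List.length_take]; omega), List.nil_append, List.take_left']
  rfl

/-- **The splice of a self-avoiding walk and a disjoint self-avoiding block, glued by two edges, is a self-avoiding
walk from the same origin.** [cite: MadrasSlade1993, §3.2 (concatenation of polygons)] -/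
theorem splice_mem_triSL (hω : ω ∈ triSL N) (hsN : s + 1 ≤ N) {a z : Site 2}
    (hΛc : List.IsChain triGraph.Adj Λ) (hΛn : Λ.Nodup) (hdisj : ∀ x ∈ Λ, x ∉ ω)
    (ha : Λ.head? = some a) (hsa : triGraph.Adj (ω.getD s 0) a)
    (hz : Λ.getLast? = some z) (hzs : triGraph.Adj z (ω.getD (s + 1) 0)) :
    splice s Λ ω ∈ triSL (N + Λ.length) := by
  have hl := length_of_mem_triSL hω
  have hs : s + 1 ≤ ω.length := by omega
  have hΛ0 : 0 < Λ.length := List.length_pos_of_ne_nil (by rintro rfl; simp at ha)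
  set L := Λ.length with hL
  have hhead : Λ.getD 0 0 = a := by
    rw [List.getD_eq_getElem?_getD, ← List.head?_eq_getElem?, ha, Option.getD_some]
  have hlast : Λ.getD (L - 1) 0 = z := by
    rw [List.getD_eq_getElem?_getD, ← List.getLast?_eq_getElem?, hz, Option.getD_some]
  have hchain : ∀ k, k + 1 < L → triGraph.Adj (Λ.getD k 0) (Λ.getD (k + 1) 0) := by
    intro k hk
    have hc := List.isChain_iff_getElem.1 hΛc k (by omega)
    rwa [List.getElem_eq_getD (0 : Site 2), List.getElem_eq_getD (0 : Site 2)] at hc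
  refine mem_triSL_of (by rw [length_splice hs, hl]; omega) ?_ ?_ ?_
  · rw [getD_splice_of_le hs (Nat.zero_le s)]
    exact getD_zero_of_mem_triSL hω
  · intro i hi
    rcases Nat.lt_or_ge (i + 1) (s + 1) with h1 | h1
    · rw [getD_splice_of_le hs (by omega), getD_splice_of_le hs (by omega)]
      exact adj_getD_of_mem_triSL hω (by omega)
    rcases Nat.lt_or_ge i (s + 1) with h2 | h2
    · have his : i = s := by omega
      subst his
      rw [getD_splice_of_le hs le_rfl, show i + 1 = i + 1 + 0 by rfl, getD_splice_block hs hΛ0, hhead]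
      exact hsa
    rcases Nat.lt_or_ge (i + 1) (s + 1 + L) with h3 | h3
    · obtain ⟨k, rfl⟩ : ∃ k, i = s + 1 + k := ⟨i - (s + 1), by omega⟩
      rw [getD_splice_block hs (by omega), show s + 1 + k + 1 = s + 1 + (k + 1) by omega,
        getD_splice_block hs (by omega)]
      exact hchain k (by omega)
    rcases Nat.lt_or_ge i (s + 1 + L) with h4 | h4
    · have hi' : i = s + 1 + (L - 1) := by omega
      rw [hi', getD_splice_block hs (by omega), show s + 1 + (L - 1) + 1 = s + 1 + L by omega,
        getD_splice_of_ge hs le_rfl, show s + 1 + L - L = s + 1 by omega, hlast]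
      exact hzs
    · rw [getD_splice_of_ge hs h4, getD_splice_of_ge hs (by omega), show i + 1 - L = (i - L) + 1 by omega]
      exact adj_getD_of_mem_triSL hω (by omega)
  · have hperm : (splice s Λ ω).Perm (Λ ++ ω) := by
      have h := (List.perm_append_comm (l₁ := ω.take (s + 1)) (l₂ := Λ)).append_right (ω.drop (s + 1))
      simpa only [splice, List.append_assoc, List.take_append_drop] using h
    rw [hperm.nodup_iff]
    exact hΛn.append (nodup_of_mem_triSL hω) fun x hx hx' => hdisj x hx hx'

/-- The endpoint of the splice. [cite: MadrasSlade1993, §3.2 (concatenation of polygons; bookkeeping)] -/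
theorem getD_splice_last (hω : ω ∈ triSL N) (hsN : s + 1 ≤ N) :
    (splice s Λ ω).getD (N + Λ.length) 0 = ω.getD N 0 := by
  have hl := length_of_mem_triSL hω
  rw [getD_splice_of_ge (by omega) (by omega), Nat.add_sub_cancel]

/-! ### Rotated, possibly reversed, translated polygon paths -/

/-- The index map of a rotation (forward, `d = true`) or a reversed rotation (`d = false`) of `ℤ/m`, started at
`r`, written without `%`. [cite: MadrasSlade1993, §3.2 (concatenation of polygons; bookkeeping)] -/
def rot (m r : ℕ) (d : Bool) (k : ℕ) : ℕ :=
  if d then (if r + k < m then r + k else r + k - m) else (if k ≤ r then r - k else r + m - k)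

/-- The inverse index map. [cite: MadrasSlade1993, §3.2 (concatenation of polygons; bookkeeping)] -/
def rotInv (m r : ℕ) (d : Bool) (i : ℕ) : ℕ :=
  if d then (if r ≤ i then i - r else i + m - r) else (if i ≤ r then r - i else r + m - i)

/-- Bookkeeping (`rot_lt`). [cite: MadrasSlade1993, §3.2 (concatenation of polygons; bookkeeping)] -/
theorem rot_lt {m r : ℕ} (d : Bool) {k : ℕ} (hr : r < m) (hk : k < m) : rot m r d k < m := by
  unfold rot; split_ifs <;> omega

/-- Bookkeeping (`rotInv_lt`). [cite: MadrasSlade1993, §3.2 (concatenation of polygons; bookkeeping)] -/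
theorem rotInv_lt {m r : ℕ} (d : Bool) {i : ℕ} (hr : r < m) (hi : i < m) : rotInv m r d i < m := by
  unfold rotInv; split_ifs <;> omega

/-- Bookkeeping (`rot_rotInv`). [cite: MadrasSlade1993, §3.2 (concatenation of polygons; bookkeeping)] -/
theorem rot_rotInv {m r : ℕ} (d : Bool) {i : ℕ} (hr : r < m) (hi : i < m) : rot m r d (rotInv m r d i) = i := by
  unfold rot rotInv; cases d <;> simp only [Bool.false_eq_true, ↓reduceIte] <;> split_ifs <;> omega

/-- Bookkeeping (`rotInv_rot`). [cite: MadrasSlade1993, §3.2 (concatenation of polygons; bookkeeping)] -/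
theorem rotInv_rot {m r : ℕ} (d : Bool) {k : ℕ} (hr : r < m) (hk : k < m) : rotInv m r d (rot m r d k) = k := by
  unfold rot rotInv; cases d <;> simp only [Bool.false_eq_true, ↓reduceIte] <;> split_ifs <;> omega

/-- Bookkeeping (`rot_zero`). [cite: MadrasSlade1993, §3.2 (concatenation of polygons; bookkeeping)] -/
theorem rot_zero {m r : ℕ} (d : Bool) (hr : r < m) : rot m r d 0 = r := by
  unfold rot; cases d <;> simp only [Bool.false_eq_true, ↓reduceIte] <;> split_ifs <;> omega

/-- Consecutive values of `rot`: either a unit step in `ℤ/m` (no wrap), or the wrap between `m - 1` and `0`.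
[cite: MadrasSlade1993, §3.2 (concatenation of polygons; bookkeeping)] -/
theorem rot_succ {m r : ℕ} (d : Bool) {k : ℕ} (hr : r < m) (hk : k + 1 < m) :
    (d = true ∧ (rot m r d (k + 1) = rot m r d k + 1 ∨ (rot m r d k = m - 1 ∧ rot m r d (k + 1) = 0))) ∨
    (d = false ∧ (rot m r d k = rot m r d (k + 1) + 1 ∨ (rot m r d k = 0 ∧ rot m r d (k + 1) = m - 1))) := by
  unfold rot; cases d <;> simp only [Bool.false_eq_true, ↓reduceIte, true_and, false_and,
    false_or] <;> split_ifs <;> omega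

/-- The polygon `lam` (a vertex list), read from index `r` in direction `d` and translated by `τ`.
[cite: MadrasSlade1993, §3.2 (concatenation of polygons)] -/
def polyPath (lam : List (Site 2)) (τ : Site 2) (r : ℕ) (d : Bool) : List (Site 2) :=
  (List.range lam.length).map fun k => lam.getD (rot lam.length r d k) 0 + τ

/-- Decoding a polygon rooted at `0` from its rotated translated path. [cite: MadrasSlade1993, §3.2 (concatenation of polygons; bookkeeping)] -/
def polyDecode (P : List (Site 2)) (r : ℕ) (d : Bool) : List (Site 2) :=
  (List.range P.length).map fun i => P.getD (rotInv P.length r d i) 0 - P.getD (rotInv P.length r d 0) 0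

/-- Bookkeeping (`length_polyPath`). [cite: MadrasSlade1993, §3.2 (concatenation of polygons; bookkeeping)] -/
@[simp] theorem length_polyPath (lam : List (Site 2)) (τ : Site 2) (r : ℕ) (d : Bool) :
    (polyPath lam τ r d).length = lam.length := by
  simp [polyPath]

/-- Bookkeeping (`length_polyDecode`). [cite: MadrasSlade1993, §3.2 (concatenation of polygons; bookkeeping)] -/
@[simp] theorem length_polyDecode (P : List (Site 2)) (r : ℕ) (d : Bool) : (polyDecode P r d).length = P.length := by
  simp [polyDecode]

/-- Entries of a mapped range (private copy of a bookkeeping lemma). [folklore] -/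
private theorem getD_range_map {α : Type*} (f : ℕ → α) (dflt : α) {m k : ℕ} (hk : k < m) :
    ((List.range m).map f).getD k dflt = f k := by
  rw [List.getD_eq_getElem _ _ (by simpa using hk)]
  simp

/-- Bookkeeping (`getD_polyPath`). [cite: MadrasSlade1993, §3.2 (concatenation of polygons; bookkeeping)] -/
theorem getD_polyPath {lam : List (Site 2)} {τ : Site 2} {r : ℕ} {d : Bool} {k : ℕ} (hk : k < lam.length) :
    (polyPath lam τ r d).getD k 0 = lam.getD (rot lam.length r d k) 0 + τ :=
  getD_range_map _ _ hk

/-- **Decoding inverts the path construction** for a polygon rooted at `lam_0 = 0`. [cite: MadrasSlade1993, §3.2 (concatenation of polygons; bookkeeping)] -/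
theorem polyDecode_polyPath {lam : List (Site 2)} {τ : Site 2} {r : ℕ} (d : Bool) (hr : r < lam.length)
    (h0 : lam.getD 0 0 = 0) : polyDecode (polyPath lam τ r d) r d = lam := by
  set m := lam.length with hm
  refine List.ext_getElem (by simp) fun i h₁ h₂ => ?_
  rw [List.getElem_eq_getD 0, List.getElem_eq_getD 0]
  have hi : i < m := by omega
  rw [polyDecode, length_polyPath, getD_range_map _ _ hi, getD_polyPath (rotInv_lt d hr hi),
    getD_polyPath (rotInv_lt d hr (by omega)), rot_rotInv d hr hi, rot_rotInv d hr (by omega), h0]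
  abel

/-- Bookkeeping (`mem_polyPath_iff`). [cite: MadrasSlade1993, §3.2 (concatenation of polygons; bookkeeping)] -/
theorem mem_polyPath_iff {lam : List (Site 2)} {τ : Site 2} {r : ℕ} {d : Bool} (hr : r < lam.length) {x : Site 2} :
    x ∈ polyPath lam τ r d ↔ ∃ i < lam.length, x = lam.getD i 0 + τ := by
  simp only [polyPath, List.mem_map, List.mem_range]
  constructor
  · rintro ⟨k, hk, rfl⟩
    exact ⟨_, rot_lt d hr hk, rfl⟩
  · rintro ⟨i, hi, rfl⟩
    exact ⟨rotInv _ r d i, rotInv_lt d hr hi, by rw [rot_rotInv d hr hi]⟩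

/-- Bookkeeping (`head?_polyPath`). [cite: MadrasSlade1993, §3.2 (concatenation of polygons; bookkeeping)] -/
theorem head?_polyPath {lam : List (Site 2)} {τ : Site 2} {r : ℕ} (d : Bool) (hr : r < lam.length) :
    (polyPath lam τ r d).head? = some (lam.getD r 0 + τ) := by
  rw [List.head?_eq_getElem?, List.getElem?_eq_getElem (by simp; omega), Option.some_inj,
    List.getElem_eq_getD 0, getD_polyPath (by omega), rot_zero d hr]

/-- Bookkeeping (`getLast?_polyPath`). [cite: MadrasSlade1993, §3.2 (concatenation of polygons; bookkeeping)] -/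
theorem getLast?_polyPath {lam : List (Site 2)} {τ : Site 2} {r : ℕ} (d : Bool) (hr : r < lam.length) :
    (polyPath lam τ r d).getLast? = some (lam.getD (rot lam.length r d (lam.length - 1)) 0 + τ) := by
  rw [List.getLast?_eq_getElem?, length_polyPath, List.getElem?_eq_getElem (by simp; omega), Option.some_inj,
    List.getElem_eq_getD 0, getD_polyPath (by omega)]

/-- **The translated rotated polygon path is a self-avoiding chain** when `lam ∈ loopSL (m - 1)` (a polygon through
`0` with `m` vertices). [cite: MadrasSlade1993, §3.2 (concatenation of polygons)] -/
theorem polyPath_isChain {M : ℕ} {lam : List (Site 2)} (hlam : lam ∈ loopSL M) (τ : Site 2) {r : ℕ} (d : Bool)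
    (hr : r < lam.length) : List.IsChain triGraph.Adj (polyPath lam τ r d) := by
  have hlamS := (mem_loopSL.1 hlam).1
  have hl := length_of_mem_triSL hlamS
  have hcyc : ∀ i j, (j = i + 1 ∨ (i = M ∧ j = 0) ∨ i = j + 1 ∨ (i = 0 ∧ j = M)) → i ≤ M → j ≤ M →
      triGraph.Adj (lam.getD i 0 + τ) (lam.getD j 0 + τ) := by
    intro i j hij hi hj
    rw [triGraph_adj_iff_adj_zero_sub, add_sub_add_right_eq_sub, ← triGraph_adj_iff_adj_zero_sub]
    rcases hij with rfl | ⟨rfl, rfl⟩ | rfl | ⟨rfl, rfl⟩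
    · exact adj_getD_of_mem_triSL hlamS (by omega)
    · rw [getD_zero_of_mem_triSL hlamS]; exact (mem_loopSL.1 hlam).2
    · exact (adj_getD_of_mem_triSL hlamS (by omega)).symm
    · rw [getD_zero_of_mem_triSL hlamS]; exact (mem_loopSL.1 hlam).2.symm
  refine List.isChain_iff_getElem.2 fun k hk => ?_
  rw [length_polyPath] at hk
  rw [List.getElem_eq_getD 0, List.getElem_eq_getD 0, getD_polyPath (by omega), getD_polyPath (by omega)]
  have h1 := rot_lt d hr (show k < lam.length by omega)
  have h2 := rot_lt d hr (show k + 1 < lam.length by omega)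
  rcases rot_succ d hr (show k + 1 < lam.length by omega) with ⟨-, h | ⟨h, h'⟩⟩ | ⟨-, h | ⟨h, h'⟩⟩
  · exact hcyc _ _ (Or.inl h) (by omega) (by omega)
  · exact hcyc _ _ (Or.inr (Or.inl ⟨by omega, h'⟩)) (by omega) (by omega)
  · exact hcyc _ _ (Or.inr (Or.inr (Or.inl h))) (by omega) (by omega)
  · exact hcyc _ _ (Or.inr (Or.inr (Or.inr ⟨h, by omega⟩))) (by omega) (by omega)

/-- Bookkeeping (`polyPath_nodup`). [cite: MadrasSlade1993, §3.2 (concatenation of polygons; bookkeeping)] -/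
theorem polyPath_nodup {M : ℕ} {lam : List (Site 2)} (hlam : lam ∈ loopSL M) (τ : Site 2) {r : ℕ} (d : Bool)
    (hr : r < lam.length) : (polyPath lam τ r d).Nodup := by
  have hlamS := (mem_loopSL.1 hlam).1
  have hl := length_of_mem_triSL hlamS
  rw [polyPath]
  refine (List.nodup_range.map_on fun k hk l hlk e => ?_)
  rw [List.mem_range] at hk hlk
  have e' := getD_injOn_of_mem_triSL hlamS (by have := rot_lt d hr hk; omega)
    (by have := rot_lt d hr hlk; omega) (add_right_cancel e)
  rw [← rotInv_rot d hr hk, ← rotInv_rot d hr hlk, e']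

end PolygonInsertion

end Literature.Probability.RandomPlanarGeometry.SAW
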